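import Summits.ValiantsHypothesis.ValiantsHypothesis.Theorems.LacunarySymmetroidMatrixDescartesFanLawFour
import Summits.ValiantsHypothesis.ValiantsHypothesis.Theorems.LacunarySymmetroidMatrixDescartesFanLawThreeAlt

/-!
# `MatrixDescartes` (stmt-ValiantsHypothesis-18050), line `Lift` — the signed fan law WITHOUT definiteness,
# in ALTERNATION currency (a phantom definite letter is added and sent to zero)

HONEST FRAMING.  Cell `pub-symmetroid`, seat `val-sym-mdr-p2` (gen 3); helper `--supports` the crux
`Theses.LacunarySymmetroid.MatrixDescartes`, NO closure claim.  Companion of `…FanLawFour.lean`.  A K-free SECTOR law;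
nothing here bears on `stub_twoSided` in general, the crux in its window, `DoorA26`/`DoorA34`, or `VP ≠ VNP`.

WHAT IS PROVED (`fanLawFourAlt_lower`, `fanLawFourAlt_upper`, word form `fanWordFour_alternation_le`).
`F(X) = X^e J + ∑ k, X^{d k} P k`, `J` and the factoring letter `P k₀` (gap `a > 0`) ANY real symmetric matrices, every
other letter semidefinite of the sign dictated by its position: `⪰ 0` on the side opposite to `k₀` with gap `≤ a`,
`⪰ 0` on the side of `k₀` with gap in `(a, 2a]`, `⪯ 0` on the side of `k₀` with gap in `(0, a)` — the exponent-axis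
pattern `(+)^* (?) (−)^* (?) (+)^*` inside the kernel window.  Then `det F` alternates in sign along at most
`2 · card ι + 1` positive points (`0 < τ₀ < ⋯ < τ_N`, `det F(τ_j) det F(τ_{j+1}) < 0 ⇒ N ≤ 2 · card ι`); in particular
every positive zero of odd multiplicity is counted and no sign-alternation certificate exceeds `2 · card ι`.  No
definiteness is assumed anywhere: the proof ADDS a phantom letter `ε X^{f} · 1` at an admissible boundary exponent
(`f = e + a` for a lower fan, `f = e + 2a` for an upper fan), which supplies the definite companion of
`…FanLawFour`, and lets `ε → 0⁺` at the finitely many test points (continuity of `det`).  [folklore]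
-/

-- layout Summits/ValiantsHypothesis/ValiantsHypothesis forces the duplicated namespace component
set_option linter.dupNamespace false

namespace Summit.ValiantsHypothesis.ValiantsHypothesis.Theorems.LacunarySymmetroidMatrixDescartes

open Polynomial Matrix Finset Filter Topology
open scoped BigOperators
open Summit.ValiantsHypothesis.ValiantsHypothesis.Theorems.SymmetroidDescartes (le_card_posRoots_of_alternating)

namespace FanLawFourAlt

variable {ι : Type} [Fintype ι] [DecidableEq ι] {κ : Type} [Fintype κ] [DecidableEq κ]

omit [Fintype ι] [DecidableEq κ] in
/-- The pencil with a phantom letter `ε·1` at exponent `f`, evaluated at `t`, is the original matrix plus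
`(ε t^f)·1`. [folklore] -/
theorem phantom_eval (e : ℕ) (d : κ → ℕ) (J : Matrix ι ι ℝ) (P : κ → Matrix ι ι ℝ) (f : ℕ) (ε t : ℝ) :
    t ^ e • J + ∑ x : κ ⊕ Unit, t ^ (Sum.elim d (fun _ => f) x) • Sum.elim P (fun _ => ε • (1 : Matrix ι ι ℝ)) x
      = (t ^ e • J + ∑ k, t ^ d k • P k) + (ε * t ^ f) • (1 : Matrix ι ι ℝ) := by
  rw [Fintype.sum_sum_type]
  simp only [Sum.elim_inl, Sum.elim_inr, Finset.univ_unique, Finset.sum_singleton, smul_smul, mul_comm ε]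
  abel

omit [DecidableEq κ] in
/-- **Alternations are bounded by the phantom-perturbed root budget.**  If for every `ε > 0` the pencil with one
extra letter `ε·1` at exponent `f` has at most `B` distinct positive determinant zeros, then
`det (X^e J + ∑ X^{d k} P k)` alternates in sign along at most `B + 1` positive points. [folklore] -/
theorem alternation_le_of_phantom (e : ℕ) (d : κ → ℕ) (J : Matrix ι ι ℝ) (P : κ → Matrix ι ι ℝ) (f : ℕ)
    (B : ℕ) (hB : ∀ ε : ℝ, 0 < ε →
      ((Matrix.det (((Polynomial.X : Polynomial ℝ) ^ e) • J.map Polynomial.C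
        + ∑ x : κ ⊕ Unit, ((Polynomial.X : Polynomial ℝ) ^ (Sum.elim d (fun _ => f) x))
          • (Sum.elim P (fun _ => ε • (1 : Matrix ι ι ℝ)) x).map Polynomial.C)
          ).roots.toFinset.filter (fun t => 0 < t)).card ≤ B)
    (N : ℕ) (τ : Fin (N + 1) → ℝ) (hτ : StrictMono τ) (hτpos : ∀ j, 0 < τ j)
    (halt : ∀ j : Fin N,
      (Matrix.det (((Polynomial.X : Polynomial ℝ) ^ e) • J.map Polynomial.C
        + ∑ k, ((Polynomial.X : Polynomial ℝ) ^ d k) • (P k).map Polynomial.C)).eval (τ j.castSucc)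
      * (Matrix.det (((Polynomial.X : Polynomial ℝ) ^ e) • J.map Polynomial.C
        + ∑ k, ((Polynomial.X : Polynomial ℝ) ^ d k) • (P k).map Polynomial.C)).eval (τ j.succ) < 0) :
    N ≤ B := by
  set g : ℝ → ℝ → ℝ := fun ε t =>
    Matrix.det ((t ^ e • J + ∑ k, t ^ d k • P k) + (ε * t ^ f) • (1 : Matrix ι ι ℝ)) with hg
  have hg0 : ∀ t, g 0 t = Matrix.det (t ^ e • J + ∑ k, t ^ d k • P k) := by
    intro t
    simp [hg]
  have hgc : ∀ t, Continuous fun ε : ℝ => g ε t := fun t =>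
    Continuous.matrix_det (continuous_const.add ((continuous_id.mul continuous_const).smul continuous_const))
  have halt0 : ∀ j : Fin N, g 0 (τ j.castSucc) * g 0 (τ j.succ) < 0 := by
    intro j
    have h := halt j
    rwa [StubReverse.eval_det_pencil, StubReverse.eval_det_pencil, ← hg0, ← hg0] at h
  have hev : ∀ j : Fin N, ∀ᶠ ε in 𝓝 (0 : ℝ), g ε (τ j.castSucc) * g ε (τ j.succ) < 0 := fun j =>
    ((hgc _).mul (hgc _)).continuousAt.eventually_lt continuousAt_const (halt0 j)
  have hpos : ∀ᶠ ε in 𝓝[>] (0 : ℝ), (∀ j : Fin N, g ε (τ j.castSucc) * g ε (τ j.succ) < 0) ∧ 0 < ε :=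
    ((Filter.eventually_all.2 hev).filter_mono nhdsWithin_le_nhds).and self_mem_nhdsWithin
  obtain ⟨ε, hεalt, hε⟩ := hpos.exists
  have haltε : ∀ j : Fin N,
      (Matrix.det (((Polynomial.X : Polynomial ℝ) ^ e) • J.map Polynomial.C
        + ∑ x : κ ⊕ Unit, ((Polynomial.X : Polynomial ℝ) ^ (Sum.elim d (fun _ => f) x))
          • (Sum.elim P (fun _ => ε • (1 : Matrix ι ι ℝ)) x).map Polynomial.C)).eval (τ j.castSucc)
      * (Matrix.det (((Polynomial.X : Polynomial ℝ) ^ e) • J.map Polynomial.C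
        + ∑ x : κ ⊕ Unit, ((Polynomial.X : Polynomial ℝ) ^ (Sum.elim d (fun _ => f) x))
          • (Sum.elim P (fun _ => ε • (1 : Matrix ι ι ℝ)) x).map Polynomial.C)).eval (τ j.succ) < 0 := by
    intro j
    rw [StubReverse.eval_det_pencil, StubReverse.eval_det_pencil, phantom_eval, phantom_eval]
    exact hεalt j
  exact (le_card_posRoots_of_alternating _ N τ hτ hτpos haltε).trans (hB ε hε)

/-- **Signed lower fan law, alternation form (no definiteness).**  Factoring letter `k₀` below the pivot (any
symmetric matrix), gap `a = e − d k₀`; every other letter above with gap `≤ a` and `⪰ 0`, or below with gap in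
`(0, a)` and `⪯ 0`, or below with gap in `(a, 2a]` and `⪰ 0` ⇒ at most `2 · card ι` sign alternations. [folklore] -/
theorem fanLawFourAlt_lower (e : ℕ) (d : κ → ℕ) (J : Matrix ι ι ℝ) (P : κ → Matrix ι ι ℝ) (k₀ : κ)
    (hJ : J.IsSymm) (hP₀ : (P k₀).IsSymm) (hlow : d k₀ < e)
    (hfan : ∀ k, k ≠ k₀ → (e < d k ∧ d k - e ≤ e - d k₀ ∧ (P k).PosSemidef)
      ∨ (d k < e ∧ e - d k < e - d k₀ ∧ (-P k).PosSemidef)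
      ∨ (d k < e ∧ e - d k₀ < e - d k ∧ e - d k ≤ 2 * (e - d k₀) ∧ (P k).PosSemidef))
    (N : ℕ) (τ : Fin (N + 1) → ℝ) (hτ : StrictMono τ) (hτpos : ∀ j, 0 < τ j)
    (halt : ∀ j : Fin N,
      (Matrix.det (((Polynomial.X : Polynomial ℝ) ^ e) • J.map Polynomial.C
        + ∑ k, ((Polynomial.X : Polynomial ℝ) ^ d k) • (P k).map Polynomial.C)).eval (τ j.castSucc)
      * (Matrix.det (((Polynomial.X : Polynomial ℝ) ^ e) • J.map Polynomial.C
        + ∑ k, ((Polynomial.X : Polynomial ℝ) ^ d k) • (P k).map Polynomial.C)).eval (τ j.succ) < 0) :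
    N ≤ 2 * Fintype.card ι := by
  classical
  refine alternation_le_of_phantom e d J P (e + (e - d k₀)) _ (fun ε hε => ?_) N τ hτ hτpos halt
  have hε1 : (ε • (1 : Matrix ι ι ℝ)).PosDef := Matrix.PosDef.one.smul hε
  refine FanLawFour.fanLawFour_lower (κ := κ ⊕ Unit) e (Sum.elim d (fun _ => e + (e - d k₀))) J
    (Sum.elim P (fun _ => ε • (1 : Matrix ι ι ℝ))) (Sum.inl k₀) hJ (by simpa using hP₀) (by simpa using hlow)
    (fun k hk => ?_) ⟨Sum.inr (), by simp, Or.inl ⟨by simpa using hε1, by simp⟩⟩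
  rcases k with k | u
  · have hk' : k ≠ k₀ := fun h => hk (by rw [h])
    simp only [Sum.elim_inl]
    rcases hfan k hk' with ⟨h1, h2, h3⟩ | ⟨h1, h2, h3⟩ | ⟨h1, h2, h3, h4⟩
    · rcases Nat.lt_or_eq_of_le h2 with h | h
      · exact Or.inl ⟨h1, h, h3⟩
      · exact Or.inr (Or.inl ⟨by omega, h3⟩)
    · exact Or.inr (Or.inr (Or.inl ⟨h1, h2, h3⟩))
    · rcases Nat.lt_or_eq_of_le h3 with h | h
      · exact Or.inr (Or.inr (Or.inr (Or.inl ⟨h1, h2, h, h4⟩)))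
      · exact Or.inr (Or.inr (Or.inr (Or.inr ⟨by omega, h4⟩)))
  · simp only [Sum.elim_inr]
    exact Or.inr (Or.inl ⟨rfl, hε1.posSemidef⟩)

/-- **Signed upper fan law, alternation form (no definiteness).**  Factoring letter `k₀` above the pivot (any
symmetric matrix), gap `a = d k₀ − e`; every other letter below with gap `≤ a` and `⪰ 0`, or above with gap in
`(0, a)` and `⪯ 0`, or above with gap in `(a, 2a]` and `⪰ 0` ⇒ at most `2 · card ι` sign alternations. [folklore] -/
theorem fanLawFourAlt_upper (e : ℕ) (d : κ → ℕ) (J : Matrix ι ι ℝ) (P : κ → Matrix ι ι ℝ) (k₀ : κ)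
    (hJ : J.IsSymm) (hP₀ : (P k₀).IsSymm) (hup : e < d k₀)
    (hfan : ∀ k, k ≠ k₀ → (d k < e ∧ e - d k ≤ d k₀ - e ∧ (P k).PosSemidef)
      ∨ (e < d k ∧ d k - e < d k₀ - e ∧ (-P k).PosSemidef)
      ∨ (e < d k ∧ d k₀ - e < d k - e ∧ d k - e ≤ 2 * (d k₀ - e) ∧ (P k).PosSemidef))
    (N : ℕ) (τ : Fin (N + 1) → ℝ) (hτ : StrictMono τ) (hτpos : ∀ j, 0 < τ j)
    (halt : ∀ j : Fin N,
      (Matrix.det (((Polynomial.X : Polynomial ℝ) ^ e) • J.map Polynomial.C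
        + ∑ k, ((Polynomial.X : Polynomial ℝ) ^ d k) • (P k).map Polynomial.C)).eval (τ j.castSucc)
      * (Matrix.det (((Polynomial.X : Polynomial ℝ) ^ e) • J.map Polynomial.C
        + ∑ k, ((Polynomial.X : Polynomial ℝ) ^ d k) • (P k).map Polynomial.C)).eval (τ j.succ) < 0) :
    N ≤ 2 * Fintype.card ι := by
  classical
  refine alternation_le_of_phantom e d J P (e + 2 * (d k₀ - e)) _ (fun ε hε => ?_) N τ hτ hτpos halt
  have hε1 : (ε • (1 : Matrix ι ι ℝ)).PosDef := Matrix.PosDef.one.smul hε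
  refine FanLawFour.fanLawFour_upper (κ := κ ⊕ Unit) e (Sum.elim d (fun _ => e + 2 * (d k₀ - e))) J
    (Sum.elim P (fun _ => ε • (1 : Matrix ι ι ℝ))) (Sum.inl k₀) hJ (by simpa using hP₀) (by simpa using hup)
    (fun k hk => ?_) ⟨Sum.inr (), by simp, Or.inl ⟨by simpa using hε1, by simp; omega⟩⟩
  rcases k with k | u
  · have hk' : k ≠ k₀ := fun h => hk (by rw [h])
    simp only [Sum.elim_inl]
    rcases hfan k hk' with ⟨h1, h2, h3⟩ | ⟨h1, h2, h3⟩ | ⟨h1, h2, h3, h4⟩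
    · rcases Nat.lt_or_eq_of_le h2 with h | h
      · exact Or.inl ⟨h1, h, h3⟩
      · exact Or.inr (Or.inl ⟨by omega, h3⟩)
    · exact Or.inr (Or.inr (Or.inl ⟨h1, h2, h3⟩))
    · rcases Nat.lt_or_eq_of_le h3 with h | h
      · exact Or.inr (Or.inr (Or.inr (Or.inl ⟨h1, h2, h, h4⟩)))
      · exact Or.inr (Or.inr (Or.inr (Or.inr ⟨by omega, h4⟩)))
  · simp only [Sum.elim_inr]
    exact Or.inr (Or.inr (Or.inr (Or.inr ⟨rfl, hε1.posSemidef⟩)))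

end FanLawFourAlt

open FanLawFourAlt

/-- **Signed fan words, alternation form (no definiteness)** (crux currency).  `∑ₗ X^{dₗ} Sₗ` with pivot `lp` and
factoring letter `lf ≠ lp` (gap `a > 0`) arbitrary real symmetric; every other letter semidefinite with the sign of
its position — `⪰ 0` opposite the factoring letter with gap `≤ a`, `⪰ 0` on its side with gap in `(a, 2a]`, `⪯ 0` on
its side with gap in `(0, a)`: the determinant alternates in sign along at most `2m + 1` positive points. [folklore] -/
theorem fanWordFour_alternation_le (K m : ℕ) (d : Fin K → ℕ) (S : Fin K → Matrix (Fin m) (Fin m) ℝ)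
    (lp lf : Fin K) (hne : lf ≠ lp) (hS : (S lp).IsSymm) (hSf : (S lf).IsSymm)
    (hfan : (d lf < d lp ∧ ∀ l, l ≠ lp → l ≠ lf → (d lp < d l ∧ d l - d lp ≤ d lp - d lf ∧ (S l).PosSemidef)
        ∨ (d l < d lp ∧ d lp - d l < d lp - d lf ∧ (-S l).PosSemidef)
        ∨ (d l < d lp ∧ d lp - d lf < d lp - d l ∧ d lp - d l ≤ 2 * (d lp - d lf) ∧ (S l).PosSemidef))
      ∨ (d lp < d lf ∧ ∀ l, l ≠ lp → l ≠ lf → (d l < d lp ∧ d lp - d l ≤ d lf - d lp ∧ (S l).PosSemidef)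
        ∨ (d lp < d l ∧ d l - d lp < d lf - d lp ∧ (-S l).PosSemidef)
        ∨ (d lp < d l ∧ d lf - d lp < d l - d lp ∧ d l - d lp ≤ 2 * (d lf - d lp) ∧ (S l).PosSemidef)))
    (N : ℕ) (τ : Fin (N + 1) → ℝ) (hτ : StrictMono τ) (hτpos : ∀ j, 0 < τ j)
    (halt : ∀ j : Fin N,
      (Matrix.det (∑ l, ((Polynomial.X : Polynomial ℝ) ^ d l) • (S l).map Polynomial.C)).eval (τ j.castSucc)
      * (Matrix.det (∑ l, ((Polynomial.X : Polynomial ℝ) ^ d l) • (S l).map Polynomial.C)).eval (τ j.succ)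
        < 0) :
    N ≤ 2 * m := by
  classical
  have hsplit : ∑ l, ((Polynomial.X : Polynomial ℝ) ^ d l) • (S l).map Polynomial.C
      = ((Polynomial.X : Polynomial ℝ) ^ d lp) • (S lp).map Polynomial.C
        + ∑ l : {l // l ≠ lp}, ((Polynomial.X : Polynomial ℝ) ^ d l.1) • (S l.1).map Polynomial.C := by
    rw [← Finset.add_sum_erase _ _ (Finset.mem_univ lp),
      Finset.sum_subtype (Finset.univ.erase lp) (p := fun l => l ≠ lp) (fun l => by simp [Finset.mem_erase])]
  rw [hsplit] at halt
  rcases hfan with ⟨hlow, h⟩ | ⟨hup, h⟩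
  · have := fanLawFourAlt_lower (κ := {l // l ≠ lp}) (d lp) (fun l => d l.1) (S lp) (fun l => S l.1) ⟨lf, hne⟩
      hS hSf hlow (fun l hl => h l.1 l.2 fun hll => hl (Subtype.ext hll)) N τ hτ hτpos halt
    simpa using this
  · have := fanLawFourAlt_upper (κ := {l // l ≠ lp}) (d lp) (fun l => d l.1) (S lp) (fun l => S l.1) ⟨lf, hne⟩
      hS hSf hup (fun l hl => h l.1 l.2 fun hll => hl (Subtype.ext hll)) N τ hτ hτpos halt
    simpa using this

end Summit.ValiantsHypothesis.ValiantsHypothesis.Theorems.LacunarySymmetroidMatrixDescartes
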